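import Literature.Geometry.Kaehler.FubiniStudy
import Literature.Topology.FourManifolds.ComplexProjectiveSpace
import HarnessLib

/-!
# The Fubini–Study symplectic form on `ℂℙⁿ`

Layer `Literature/Geometry/Kaehler`. Definition request `defn-FubiniStudyMFormProjectiveSpace`
(route `SmoothPoincare4/TwistorRealLines`, items `RealCongruenceRigidity`, `TwistorToStandard`).

The tree has

* the real-analytic `2n`-manifold `Literature.Topology.FourManifolds.ComplexProjectiveSpace n`
  (`Projectivization ℂ (Fin (n + 1) → ℂ)` with the `n + 1` affine charts `affineChart i`, valued in
  `EuclideanSpace ℝ (Fin (2 * n))` through `realCoordinates`, preferred chart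
  `chartAt p = affineChart (chartIndex p)`), and
* the lifted Fubini–Study form `Literature.Geometry.Kaehler.fubiniStudyForm` (`β₀ = dα₀`,
  `α₀(Z)(a) = Im ⟪Z, a⟫ / ‖Z‖²`, normalisation `β₀ = 2 Im h_FS`, Voisin (2002) §3.3.2) on a complex
  inner product space off the origin, PROVED closed (`extDeriv_fubiniStudyForm`), of type `(1,1)`
  (`fubiniStudyForm_I_smul`), positive transversally to the fibres of `W ∖ {0} → ℙ(W)`
  (`fubiniStudyForm_self_I_smul_nonneg`, `exists_eq_smul_of_fubiniStudyForm_self_I_smul_eq_zero`)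
  and projectively invariant (`fubiniStudyForm_smul_add_smul`:
  `β₀(cZ)(ca + μZ, cb + νZ) = β₀(Z)(a, b)`).

This file DESCENDS `β₀` to `ℂℙⁿ`. The Hermitian model of `ℂⁿ⁺¹` is
`𝕎 n = EuclideanSpace ℂ (Fin (n + 1))` (the function type `Fin (n + 1) → ℂ` carries the sup norm
and no inner product). Over the `i`-th affine open set `Uᵢ = {[v] | vᵢ ≠ 0}` the bundle
`𝕎 n ∖ {0} → ℂℙⁿ` has the canonical section `homLift i [v] = v / vᵢ` (smooth on `Uᵢ`), and

  `fubiniStudyMFormCP n p := (homLift (chartIndex p))^* β₀` at `p`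

(`Literature.Geometry.Kaehler.fubiniStudyMFormCP`, an
`MForm (𝓡 (2 * n)) (ComplexProjectiveSpace n) ℝ 2`). Projective invariance of `β₀` and the product
rule `d(fG) = f dG + df ⊗ G` show that the choice of section is immaterial
(`fubiniStudyMFormCP_eq_pullback_homLift`: `ω_FS = (homLift k)^* β₀` on all of `U_k`), whence, by
the proved pull-back calculus of `ManifoldFormsPullback` and the calculus of `β₀`:

* `isSmoothForm_fubiniStudyMFormCP`, `isClosedForm_fubiniStudyMFormCP` — `ω_FS` is a smooth closed
  real `2`-form (Griffiths–Harris, Ch. 0 §2, the Fubini–Study metric: `ω = (i/2π) ∂∂̄ log ‖Z‖²`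
  is a closed form, globally defined because independent of the local lift `Z`; McDuff–Salamon
  (2017), Example 4.3.3). NORMALISATION: that of
  `FubiniStudy.lean`, `β₀ = dα₀`, `α₀(Z) = Im ⟪Z, ·⟫ / ‖Z‖²`; McDuff–Salamon's `α_FS =
  (i / 4|z|²)(z·dz̄ - z̄·dz)` (Exercise 4.3.4 (i): `dα_FS = ρ_FS = pr^*ω_FS^{MS}`) is `α₀ / 2`, so
  `fubiniStudyMFormCP n = 2 · ω_FS^{MS}` (lines have area `2π`; `ω_FS^{MS}`-lines have area `π`)
  `= 2π · (i/2π)∂∂̄ log ‖Z‖²` (Griffiths–Harris' form, lines of area `1`);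
* `fubiniStudyMFormCP_pullback_toCP`, `fubiniStudyMFormCP_pullback_toCP_comp` — the UNIVERSAL
  PROPERTY: `pr^* ω_FS = β₀` on `ℂⁿ⁺¹ ∖ {0}` (`pr = toCP`, McDuff–Salamon's "`ρ_FS = pr^*ω_FS`"), and
  for every real manifold `N` and every map `G : N → 𝕎 n` differentiable at `x` with `G x ≠ 0`,
  `([G])^* ω_FS = G^* β₀` at `x`; the form in which invariance statements are proved downstream (a
  unitary or anti-unitary `A` acts on `ℂℙⁿ` through its lift, and `A^* β₀ = ± β₀`:
  `fubiniStudyForm_of_inner_map_eq`, `fubiniStudyForm_of_inner_map_eq_conj`,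
  `fubiniStudyMFormCP_pullback_eq_of_lift` (`U(n+1)`-invariance, McDuff–Salamon Exercise 5.1.3),
  `fubiniStudyMFormCP_pullback_eq_neg_of_lift`);
* `fubiniStudyMFormCP_apply_pair` — the explicit value at `p` on `v, w ∈ T_p ℂℙⁿ = ℝ²ⁿ`:
  `ω_FS(p)(v, w) = β₀(homLift i p)(Lᵢ v, Lᵢ w)`, `i = chartIndex p`, `Lᵢ = liftCLM i` the
  differential of the section (insert a `0` in slot `i` of the complexified vector);
* `fubiniStudyMFormCP_stdJ`, `fubiniStudyMFormCP_self_stdJ_pos`, `fubiniStudyMFormCP_nondegenerate`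
  — `ω_FS` is of type `(1,1)` and POSITIVE for the complex structure `stdJ n` of `ℂℙⁿ` (multiplication
  by `i` on `ℂⁿ`, read on the real model space through `realCoordinates`; this is the complex
  structure of `T_p ℂℙⁿ` in the identification `T_p ℂℙⁿ = ℝ²ⁿ` through the preferred affine chart,
  the atlas being holomorphic), hence NONDEGENERATE: `(ℂℙⁿ, ω_FS)` is a symplectic (indeed Kähler)
  manifold (McDuff–Salamon (2017), Example 4.3.3 / §4.3; Voisin (2002), §3.3.2 Lemma 3.16).

Not treated here (left to the requests that own them): the `PU(n+1)`-action and the quaternionic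
real structure `τ₀` as smooth self-maps of `ℂℙⁿ` (their effect on `ω_FS` is reduced to the lift
lemmas above), areas of lines and the total-area normalisation (integration of forms).

## References

* P. Griffiths, J. Harris, *Principles of Algebraic Geometry* (1978), Ch. 0 §2 (pp. 30–31: the
  Fubini–Study metric and its form on `ℙⁿ`, invariance under unitary transformations).
* C. Voisin, *Hodge Theory and Complex Algebraic Geometry I* (CUP 2002), §3.3.2, Lemma 3.16.
* D. McDuff, D. Salamon, *Introduction to Symplectic Topology*, 3rd ed. (OUP 2017), §4.3,
  Example 4.3.3, p. 173 (`ρ_FS = pr^*ω_FS`, closed, nondegenerate, compatible with `J`),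
  Exercise 4.3.4 (`dα_FS = ρ_FS`, `∫_{ℂP¹} ω_FS = π`), Exercise 5.1.3 (`U(n+1)`-invariance).
-/

noncomputable section

open scoped ComplexConjugate InnerProductSpace ContDiff Topology Manifold
open Complex ContinuousLinearMap Bundle Set Filter Function

namespace Literature.Geometry.Kaehler

open Literature.Topology.FourManifolds Literature.Topology.FourManifolds.ComplexProjectiveSpace

/-! ## Part 1. Pull-backs of `β₀` along maps of a real manifold into `W ∖ {0}` -/

section RealManifold

variable {EN : Type*} [NormedAddCommGroup EN] [NormedSpace ℝ EN]
  {HN : Type*} [TopologicalSpace HN] {IN : ModelWithCorners ℝ EN HN}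
  {N : Type*} [TopologicalSpace N] [ChartedSpace HN N]
  {W : Type*} [NormedAddCommGroup W] [InnerProductSpace ℂ W]

/-- **Product rule on a real manifold, complex scalars.** For `f : N → ℂ` and `G : N → W` with
differentials `f'`, `G'` at `x` (maps of real manifolds into the real normed spaces `ℂ`, `W`), the
map `y ↦ f y • G y` has differential `f x • G' + f' ⊗ G x` at `x` (the manifold `HasMFDerivAt` is
`HasFDerivWithinAt` of the map written in the chart at `x`, where Mathlib's
`HasFDerivWithinAt.smul` applies). [folklore] -/
theorem hasMFDerivAt_smul_complex {f : N → ℂ} {G : N → W} {x : N}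
    {f' : TangentSpace IN x →L[ℝ] ℂ} {G' : TangentSpace IN x →L[ℝ] W}
    (hf : HasMFDerivAt IN 𝓘(ℝ, ℂ) f x f') (hG : HasMFDerivAt IN 𝓘(ℝ, W) G x G') :
    HasMFDerivAt IN 𝓘(ℝ, W) (fun y ↦ f y • G y) x (f x • G' + f'.smulRight (G x)) := by
  refine ⟨hf.1.smul hG.1, ?_⟩
  have h := hf.2.smul hG.2
  have e1 : writtenInExtChartAt IN 𝓘(ℝ, ℂ) x f (extChartAt IN x x) = f x := by
    simp [writtenInExtChartAt]
  have e2 : writtenInExtChartAt IN 𝓘(ℝ, W) x G (extChartAt IN x x) = G x := by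
    simp [writtenInExtChartAt]
  rw [e1, e2] at h
  exact h

/-- The differential of `y ↦ f y • G y`, evaluated: `d(fG)_x v = f x • dG_x v + (df_x v) • G x`
(values in `W`, Mathlib's `mvfderiv`). [folklore] -/
theorem mvfderiv_smul_complex_apply {f : N → ℂ} {G : N → W} {x : N}
    (hf : MDifferentiableAt IN 𝓘(ℝ, ℂ) f x) (hG : MDifferentiableAt IN 𝓘(ℝ, W) G x)
    (v : TangentSpace IN x) :
    mvfderiv IN (fun y ↦ f y • G y) x v =
      f x • mvfderiv IN G x v + (mvfderiv IN f x v) • G x := by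
  have h := (hasMFDerivAt_smul_complex hf.hasMFDerivAt hG.hasMFDerivAt).mfderiv
  exact congrArg (fun L : TangentSpace IN x →L[ℝ] TangentSpace 𝓘(ℝ, W) (f x • G x) ↦
    (show W from L v)) h

/-- `mvfderiv` only depends on the germ of the map (any source model). [folklore] -/
theorem mvfderiv_congr_of_eventuallyEq' {F' : Type*} [NormedAddCommGroup F'] [NormedSpace ℝ F']
    {g g' : N → F'} {x : N} (h : g =ᶠ[𝓝 x] g') :
    mvfderiv IN g x = mvfderiv IN g' x := by
  have h1 := h.mfderiv_eq (I := IN) (I' := 𝓘(ℝ, F'))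
  ext v
  exact congrArg (fun L : TangentSpace IN x →L[ℝ] TangentSpace 𝓘(ℝ, F') (g x) ↦
    (show F' from L v)) h1

/-- The differential of `A ∘ G` for a continuous real-linear map `A` is `A ∘ dG` (chain rule,
values in the target space). [folklore] -/
theorem mvfderiv_clm_comp_apply {F' F'' : Type*} [NormedAddCommGroup F'] [NormedSpace ℝ F']
    [NormedAddCommGroup F''] [NormedSpace ℝ F''] (A : F' →L[ℝ] F'') {G : N → F'} {x : N}
    (hG : MDifferentiableAt IN 𝓘(ℝ, F') G x) (v : TangentSpace IN x) :
    mvfderiv IN (A ∘ G) x v = A (mvfderiv IN G x v) := by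
  have h := mfderiv_comp x (A.hasMFDerivAt (x := G x)).mdifferentiableAt hG
  rw [A.mfderiv_eq] at h
  exact congrArg (fun L : TangentSpace IN x →L[ℝ] TangentSpace 𝓘(ℝ, F'') (A (G x)) ↦
    (show F'' from L v)) h

/-- Evaluation of the pull-back of the Fubini–Study form `β₀` of `W ∖ {0}` along a map `G : N → W`
of a real manifold: `(G^*β₀)(x)(v₀, v₁) = β₀(G x)(dG_x v₀, dG_x v₁)`.
[cite: VoisinHodgeI2002, §3.1.3] -/
theorem fubiniStudyMForm_pullback_apply (G : N → W) (x : N) (v : Fin 2 → TangentSpace IN x) :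
    (fubiniStudyMForm (W := W)).pullback IN G x v =
      fubiniStudyForm (G x) ![mvfderiv IN G x (v 0), mvfderiv IN G x (v 1)] := by
  rw [eq_vecCons_two v]
  simp only [MForm.pullback_apply, fubiniStudyMForm_apply]
  congr 1
  funext i
  fin_cases i <;> rfl

/-- **Projective invariance of `β₀` under the product rule.** If `f : N → ℂ` and `G : N → W` are
differentiable at `x` with `f x ≠ 0`, `G x ≠ 0`, then
`β₀(f x • G x)(d(fG)_x v, d(fG)_x w) = β₀(G x)(dG_x v, dG_x w)`: `d(fG) = f dG + df ⊗ G` and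
`β₀(cZ)(ca + μZ, cb + νZ) = β₀(Z)(a, b)` (Voisin (2002), §3.3.1: the local forms `ωᵢ` "coincide
on `Uᵢ ∩ Uⱼ`"). [cite: VoisinHodgeI2002, §3.3.1] -/
theorem fubiniStudyForm_mvfderiv_smul {f : N → ℂ} {G : N → W} {x : N}
    (hf : MDifferentiableAt IN 𝓘(ℝ, ℂ) f x) (hG : MDifferentiableAt IN 𝓘(ℝ, W) G x)
    (hf0 : f x ≠ 0) (hG0 : G x ≠ 0) (v w : TangentSpace IN x) :
    fubiniStudyForm (f x • G x)
        ![mvfderiv IN (fun y ↦ f y • G y) x v, mvfderiv IN (fun y ↦ f y • G y) x w] =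
      fubiniStudyForm (G x) ![mvfderiv IN G x v, mvfderiv IN G x w] := by
  rw [mvfderiv_smul_complex_apply hf hG, mvfderiv_smul_complex_apply hf hG]
  exact fubiniStudyForm_smul_add_smul hG0 hf0 _ _ _ _

/-- **The pull-back of `β₀` only depends on the induced map to `ℙ(W)`**: for `f`, `G`
differentiable at `x` with `f x ≠ 0`, `G x ≠ 0`, `(fG)^*β₀ = G^*β₀` at `x`.
[cite: VoisinHodgeI2002, §3.3.1] -/
theorem fubiniStudyMForm_pullback_smul {f : N → ℂ} {G : N → W} {x : N}
    (hf : MDifferentiableAt IN 𝓘(ℝ, ℂ) f x) (hG : MDifferentiableAt IN 𝓘(ℝ, W) G x)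
    (hf0 : f x ≠ 0) (hG0 : G x ≠ 0) :
    (fubiniStudyMForm (W := W)).pullback IN (fun y ↦ f y • G y) x =
      (fubiniStudyMForm (W := W)).pullback IN G x := by
  ext v
  rw [fubiniStudyMForm_pullback_apply, fubiniStudyMForm_pullback_apply]
  exact fubiniStudyForm_mvfderiv_smul hf hG hf0 hG0 _ _

/-- **`β₀` is invariant under maps preserving the Hermitian product** (unitary maps; they need
only be assumed real-linear): `β₀(AZ)(Aa, Ab) = β₀(Z)(a, b)` (Griffiths–Harris, Ch. 0 §2: the
Fubini–Study metric is invariant under unitary transformations). [cite: GriffithsHarrisPrinciples1978, Ch. 0 §2] -/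
theorem fubiniStudyForm_of_inner_map_eq (A : W →L[ℝ] W) (hA : ∀ a b : W, ⟪A a, A b⟫_ℂ = ⟪a, b⟫_ℂ)
    {Z : W} (hZ : Z ≠ 0) (a b : W) :
    fubiniStudyForm (A Z) ![A a, A b] = fubiniStudyForm Z ![a, b] := by
  have hn : ∀ u : W, ‖A u‖ = ‖u‖ := fun u ↦ by
    rw [← pow_left_inj₀ (norm_nonneg _) (norm_nonneg _) two_ne_zero, ← inner_self_eq_norm_sq
      (𝕜 := ℂ), ← inner_self_eq_norm_sq (𝕜 := ℂ), hA]
  have hAZ : A Z ≠ 0 := fun h ↦ hZ (by rw [← norm_eq_zero, ← hn, h, norm_zero])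
  simp only [fubiniStudyForm_apply hZ, fubiniStudyForm_apply hAZ, Matrix.cons_val_zero,
    Matrix.cons_val_one, hA, hn]

/-- **`β₀` is anti-invariant under maps conjugating the Hermitian product** (anti-unitary maps,
e.g. `Z ↦ conj Z` or the quaternionic structure `j` of `ℂ²ᵏ`): `β₀(AZ)(Aa, Ab) = -β₀(Z)(a, b)`,
since `β₀ = 2 Im h_FS` and `h_FS` is built from Hermitian products. [folklore] -/
theorem fubiniStudyForm_of_inner_map_eq_conj (A : W →L[ℝ] W)
    (hA : ∀ a b : W, ⟪A a, A b⟫_ℂ = conj ⟪a, b⟫_ℂ) {Z : W} (hZ : Z ≠ 0) (a b : W) :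
    fubiniStudyForm (A Z) ![A a, A b] = -fubiniStudyForm Z ![a, b] := by
  have hn : ∀ u : W, ‖A u‖ = ‖u‖ := fun u ↦ by
    rw [← pow_left_inj₀ (norm_nonneg _) (norm_nonneg _) two_ne_zero, ← inner_self_eq_norm_sq
      (𝕜 := ℂ), ← inner_self_eq_norm_sq (𝕜 := ℂ), hA, RCLike.conj_re]
  have hAZ : A Z ≠ 0 := fun h ↦ hZ (by rw [← norm_eq_zero, ← hn, h, norm_zero])
  simp only [fubiniStudyForm_apply hZ, fubiniStudyForm_apply hAZ, Matrix.cons_val_zero,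
    Matrix.cons_val_one, hA, hn, conj_re, conj_im]
  ring

end RealManifold

/-! ## Part 2. The canonical sections of `ℂⁿ⁺¹ ∖ {0} → ℂℙⁿ` over the affine open sets -/

section ProjectiveSpace

/-- Local notation: `𝕎 n` is the Hermitian space `ℂⁿ⁺¹ = EuclideanSpace ℂ (Fin (n + 1))`. -/
local notation "𝕎 " n:arg => EuclideanSpace ℂ (Fin (n + 1))

/-- Local notation: `𝔼 n` is the real model space `EuclideanSpace ℝ (Fin n)`. -/
local notation "𝔼 " n:arg => EuclideanSpace ℝ (Fin n)

variable {n : ℕ}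

/-- **The canonical lift over the `i`-th affine open set**: `homLift i [v] = v / vᵢ ∈ ℂⁿ⁺¹`, the
representative of `[v]` with `i`-th homogeneous coordinate `1` (a section of `ℂⁿ⁺¹ ∖ {0} → ℂℙⁿ`
over `Uᵢ = {vᵢ ≠ 0}`; junk value `v / 0 = 0`-wise off `Uᵢ`). Griffiths–Harris, Ch. 0 §2 (the lift
`Z` over `U₀` used to write `ω = (i/2π)∂∂̄ log ‖Z‖²`). [cite: GriffithsHarrisPrinciples1978, Ch. 0 §2] -/
def homLift (i : Fin (n + 1)) : ComplexProjectiveSpace n → 𝕎 n :=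
  Projectivization.lift
    (fun v ↦ WithLp.toLp 2 fun j ↦ (v : Fin (n + 1) → ℂ) j / (v : Fin (n + 1) → ℂ) i)
    (by
      rintro a b t h
      have ht : t ≠ 0 := by rintro rfl; exact a.2 (by simpa using h)
      congr 1
      funext j
      simp [h, mul_div_mul_left _ _ ht])

/-- `homLift i [v] = (vⱼ / vᵢ)ⱼ`. [folklore] -/
@[simp]
theorem homLift_mk (i : Fin (n + 1)) (v : {v : Fin (n + 1) → ℂ // v ≠ 0}) :
    homLift i (mk v) = WithLp.toLp 2 fun j ↦ (v : Fin (n + 1) → ℂ) j / (v : Fin (n + 1) → ℂ) i :=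
  rfl

/-- On `Uᵢ` the `i`-th coordinate of `homLift i p` is `1`. [folklore] -/
theorem homLift_apply_same {i : Fin (n + 1)} {p : ComplexProjectiveSpace n} (h : CoordNeZero i p) :
    homLift i p i = 1 := by
  induction p using ind with
  | h v => simp [div_self ((coordNeZero_mk i v).1 h)]

/-- On `Uᵢ` the lift `homLift i p` is a nonzero vector. [folklore] -/
theorem homLift_ne_zero {i : Fin (n + 1)} {p : ComplexProjectiveSpace n} (h : CoordNeZero i p) :
    homLift i p ≠ 0 := fun h0 ↦ by
  have := homLift_apply_same h
  rw [h0] at this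
  simp at this

/-- **Two canonical lifts differ by the transition function**: on `Uᵢ ∩ U_k`,
`homLift i p = ((homLift k p)ᵢ)⁻¹ • homLift k p` (`v/vᵢ = (v_k/vᵢ) · v/v_k`). [folklore] -/
theorem homLift_eq_inv_smul {i k : Fin (n + 1)} {p : ComplexProjectiveSpace n}
    (hi : CoordNeZero i p) (hk : CoordNeZero k p) :
    homLift i p = ((homLift k p) i)⁻¹ • homLift k p := by
  induction p using ind with
  | h v =>
    have hvi : (v : Fin (n + 1) → ℂ) i ≠ 0 := (coordNeZero_mk i v).1 hi
    have hvk : (v : Fin (n + 1) → ℂ) k ≠ 0 := (coordNeZero_mk k v).1 hk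
    ext j
    simp only [homLift_mk, PiLp.toLp_apply, PiLp.smul_apply, smul_eq_mul]
    field_simp

/-- **The class of a vector of the Hermitian model**: `toCP v = [v] ∈ ℂℙⁿ` for `v ≠ 0` (junk value
at `v = 0`). A total version of `ComplexProjectiveSpace.mk` on `EuclideanSpace ℂ (Fin (n + 1))`.
[folklore] -/
def toCP (v : 𝕎 n) : ComplexProjectiveSpace n :=
  if h : WithLp.ofLp v = 0 then Classical.arbitrary _ else mk ⟨WithLp.ofLp v, h⟩

/-- `toCP v = [v]` for `v ≠ 0` (as a function on `ℂⁿ⁺¹`). [folklore] -/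
theorem toCP_of_ne_zero {v : 𝕎 n} (hv : WithLp.ofLp v ≠ 0) : toCP v = mk ⟨WithLp.ofLp v, hv⟩ :=
  dif_neg hv

/-- A vector of `EuclideanSpace ℂ (Fin (n + 1))` vanishes iff its coordinate function does. [folklore] -/
theorem ofLp_eq_zero_iff (v : 𝕎 n) : WithLp.ofLp v = 0 ↔ v = 0 := by
  constructor
  · intro h
    rw [← WithLp.toLp_ofLp (p := 2) v, h, WithLp.toLp_zero]
  · rintro rfl
    rfl

/-- `toCP (c • v) = toCP v` for `c ≠ 0`, `v ≠ 0`. [folklore] -/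
theorem toCP_smul {c : ℂ} (hc : c ≠ 0) {v : 𝕎 n} (hv : v ≠ 0) : toCP (c • v) = toCP v := by
  have hv' : WithLp.ofLp v ≠ 0 := fun h ↦ hv ((ofLp_eq_zero_iff v).1 h)
  have hcv' : WithLp.ofLp (c • v) ≠ 0 := by
    rw [WithLp.ofLp_smul]
    exact smul_ne_zero hc hv'
  rw [toCP_of_ne_zero hcv', toCP_of_ne_zero hv', mk_eq_mk_iff]
  exact ⟨c, rfl⟩

/-- `[v]` lies in `Uᵢ` iff `vᵢ ≠ 0`. [folklore] -/
theorem coordNeZero_toCP_iff {v : 𝕎 n} (hv : v ≠ 0) (i : Fin (n + 1)) :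
    CoordNeZero i (toCP v) ↔ v i ≠ 0 := by
  have hv' : WithLp.ofLp v ≠ 0 := fun h ↦ hv ((ofLp_eq_zero_iff v).1 h)
  rw [toCP_of_ne_zero hv', coordNeZero_mk]

/-- The canonical lift of `[v]` over `Uᵢ` is `vᵢ⁻¹ • v`. [folklore] -/
theorem homLift_toCP {v : 𝕎 n} {i : Fin (n + 1)} (hv : v i ≠ 0) :
    homLift i (toCP v) = (v i)⁻¹ • v := by
  have hv0 : WithLp.ofLp v ≠ 0 := fun h ↦ hv (by
    have := congr_fun h i
    simpa using this)
  rw [toCP_of_ne_zero hv0, homLift_mk]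
  ext j
  simp [div_eq_inv_mul]

/-- `homLift i` is a section of `v ↦ [v]` over `Uᵢ`: `[homLift i p] = p`. [folklore] -/
theorem toCP_homLift {i : Fin (n + 1)} {p : ComplexProjectiveSpace n} (h : CoordNeZero i p) :
    toCP (homLift i p) = p := by
  induction p using ind with
  | h v =>
    have hvi : (v : Fin (n + 1) → ℂ) i ≠ 0 := (coordNeZero_mk i v).1 h
    have h0 : WithLp.ofLp (homLift i (mk v)) ≠ 0 := fun h0 ↦ by
      have := congr_fun h0 i
      simp [div_self hvi] at this
    rw [toCP_of_ne_zero h0, mk_eq_mk_iff]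
    refine ⟨((v : Fin (n + 1) → ℂ) i)⁻¹, ?_⟩
    funext j
    simp [div_eq_inv_mul]

/-! ### The sections in the affine charts: smoothness and differential -/

/-- The `i`-th canonical lift written in the `i`-th affine chart: `w ↦ (w₀, …, 1, …, w_{n-1})`
(insert `1` in slot `i` of the complexified coordinate vector), an affine map
`ℝ²ⁿ → ℂⁿ⁺¹`. [folklore] -/
def affLift (i : Fin (n + 1)) (w : 𝔼 (2 * n)) : 𝕎 n :=
  WithLp.toLp 2 (homogenize i ((realCoordinates n).symm w) : Fin (n + 1) → ℂ)

/-- Inserting a zero coordinate commutes with complex scalars. [folklore] -/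
theorem insertNth_zero_smul (i : Fin (n + 1)) (c : ℂ) (w : Fin n → ℂ) :
    Fin.insertNth (α := fun _ ↦ ℂ) i 0 (c • w) = c • Fin.insertNth (α := fun _ ↦ ℂ) i 0 w := by
  funext j
  refine Fin.succAboveCases i ?_ (fun k ↦ ?_) j
  · simp
  · simp

/-- **The differential of the canonical lift**, `Lᵢ : ℝ²ⁿ → ℂⁿ⁺¹`, `w ↦ (w₀, …, 0, …, w_{n-1})`
(insert `0` in slot `i` of the complexified vector): a continuous real-linear map. [folklore] -/
def liftCLM (i : Fin (n + 1)) : 𝔼 (2 * n) →L[ℝ] 𝕎 n :=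
  LinearMap.toContinuousLinearMap
    { toFun := fun w ↦ WithLp.toLp 2 (Fin.insertNth (α := fun _ ↦ ℂ) i 0 ((realCoordinates n).symm w))
      map_add' := fun w w' ↦ by
        rw [map_add, ← WithLp.toLp_add, ← Fin.insertNth_add, add_zero]
      map_smul' := fun r w ↦ by
        rw [map_smul, RingHom.id_apply, ← WithLp.toLp_smul, ← Complex.coe_smul,
          insertNth_zero_smul, Complex.coe_smul] }

/-- Unfolding of `liftCLM` (definitional). [folklore] -/
theorem liftCLM_apply (i : Fin (n + 1)) (w : 𝔼 (2 * n)) :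
    liftCLM i w = WithLp.toLp 2 (Fin.insertNth (α := fun _ ↦ ℂ) i 0 ((realCoordinates n).symm w)) :=
  rfl

/-- The `i`-th coordinate of `Lᵢ w` vanishes. [folklore] -/
@[simp]
theorem liftCLM_apply_same (i : Fin (n + 1)) (w : 𝔼 (2 * n)) : liftCLM i w i = 0 := by
  simp [liftCLM_apply]

/-- The other coordinates of `Lᵢ w` are the complexified coordinates of `w`. [folklore] -/
@[simp]
theorem liftCLM_apply_succAbove (i : Fin (n + 1)) (w : 𝔼 (2 * n)) (k : Fin n) :
    liftCLM i w (i.succAbove k) = (realCoordinates n).symm w k := by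
  simp [liftCLM_apply]

/-- `Lᵢ` is injective. [folklore] -/
theorem liftCLM_injective (i : Fin (n + 1)) : Injective (liftCLM (n := n) i) := by
  intro w w' h
  have h1 : (realCoordinates n).symm w = (realCoordinates n).symm w' := by
    funext k
    rw [← liftCLM_apply_succAbove, ← liftCLM_apply_succAbove, h]
  exact (realCoordinates n).symm.injective h1

/-- The affine lift is `Lᵢ` plus the constant `eᵢ`. [folklore] -/
theorem affLift_eq (i : Fin (n + 1)) (w : 𝔼 (2 * n)) :
    affLift i w = liftCLM i w + WithLp.toLp 2 (Pi.single i (1 : ℂ)) := by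
  rw [liftCLM_apply, ← WithLp.toLp_add, affLift]
  congr 1
  change Fin.insertNth (α := fun _ ↦ ℂ) i 1 ((realCoordinates n).symm w) = _
  rw [← Fin.insertNth_zero_right, ← Fin.insertNth_add, zero_add, add_zero]

/-- The affine lift has derivative `Lᵢ` everywhere. [folklore] -/
theorem hasFDerivAt_affLift (i : Fin (n + 1)) (w : 𝔼 (2 * n)) :
    HasFDerivAt (affLift (n := n) i) (liftCLM i) w := by
  have h : affLift (n := n) i = fun w ↦ liftCLM i w + WithLp.toLp 2 (Pi.single i (1 : ℂ)) :=
    funext (affLift_eq i)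
  rw [h]
  exact (liftCLM i).hasFDerivAt.add_const _

/-- The affine lift is `C^∞`. [folklore] -/
theorem contDiff_affLift (i : Fin (n + 1)) : ContDiff ℝ ∞ (affLift (n := n) i) := by
  have h : affLift (n := n) i = fun w ↦ liftCLM i w + WithLp.toLp 2 (Pi.single i (1 : ℂ)) :=
    funext (affLift_eq i)
  rw [h]
  exact (liftCLM i).contDiff.add contDiff_const

/-- **The canonical lift in its own chart**: `homLift i ∘ (affineChart i)⁻¹ = affLift i` on the
whole model space. [folklore] -/
theorem homLift_affineChart_symm (i : Fin (n + 1)) (w : 𝔼 (2 * n)) :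
    homLift i ((affineChart i).symm w) = affLift i w := by
  rw [affineChart_symm_apply, homLift_mk, affLift]
  congr 1
  funext j
  simp [homogenize]

/-- On `Uᵢ`, `homLift i = affLift i ∘ affineChart i`. [folklore] -/
theorem homLift_eq_affLift {i : Fin (n + 1)} {p : ComplexProjectiveSpace n} (h : CoordNeZero i p) :
    homLift i p = affLift i (affineChart i p) := by
  conv_lhs => rw [← (affineChart i).left_inv (show p ∈ (affineChart i).source from h)]
  exact homLift_affineChart_symm i _

/-- The affine charts are `C^∞` on their sources (members of the analytic atlas). [folklore] -/
theorem contMDiffOn_affineChart (i : Fin (n + 1)) :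
    ContMDiffOn (𝓡 (2 * n)) (𝓡 (2 * n)) ∞ (affineChart (n := n) i) (affineChart i).source :=
  contMDiffOn_of_mem_maximalAtlas (IsManifold.subset_maximalAtlas (mem_range_self i))

/-- **The canonical lift `homLift i` is `C^∞` on `Uᵢ`.** [folklore] -/
theorem contMDiffOn_homLift (i : Fin (n + 1)) :
    ContMDiffOn (𝓡 (2 * n)) 𝓘(ℝ, 𝕎 n) ∞ (homLift (n := n) i)
      {p : ComplexProjectiveSpace n | CoordNeZero i p} := by
  have h := ((contDiff_affLift (n := n) i).contMDiff).comp_contMDiffOn (contMDiffOn_affineChart i)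
  refine h.congr fun p hp ↦ ?_
  exact homLift_eq_affLift hp

/-- The canonical lift `homLift i` is `C^∞` at every point of `Uᵢ`. [folklore] -/
theorem contMDiffAt_homLift {i : Fin (n + 1)} {p : ComplexProjectiveSpace n} (h : CoordNeZero i p) :
    ContMDiffAt (𝓡 (2 * n)) 𝓘(ℝ, 𝕎 n) ∞ (homLift i) p :=
  (contMDiffOn_homLift i).contMDiffAt ((isOpen_setOf_coordNeZero i).mem_nhds h)

/-- The canonical lift `homLift i` is `C^∞` near every point of `Uᵢ`. [folklore] -/
theorem eventually_contMDiffAt_homLift {i : Fin (n + 1)} {p : ComplexProjectiveSpace n}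
    (h : CoordNeZero i p) :
    ∀ᶠ q in 𝓝 p, ContMDiffAt (𝓡 (2 * n)) 𝓘(ℝ, 𝕎 n) ∞ (homLift i) q := by
  filter_upwards [(isOpen_setOf_coordNeZero i).mem_nhds h] with q hq
  exact contMDiffAt_homLift hq

/-- The canonical lift `homLift i` is differentiable at every point of `Uᵢ`. [folklore] -/
theorem mdifferentiableAt_homLift {i : Fin (n + 1)} {p : ComplexProjectiveSpace n}
    (h : CoordNeZero i p) : MDifferentiableAt (𝓡 (2 * n)) 𝓘(ℝ, 𝕎 n) (homLift i) p :=
  (contMDiffAt_homLift h).mdifferentiableAt (by simp)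

/-- **The differential of the preferred lift.** At `p`, with `i = chartIndex p` (so that
`affineChart i` is the preferred chart at `p`, through which `T_p ℂℙⁿ` is identified with `ℝ²ⁿ`),
the lift `homLift i` has differential `Lᵢ = liftCLM i`. [folklore] -/
theorem hasMFDerivAt_homLift (p : ComplexProjectiveSpace n) :
    HasMFDerivAt (𝓡 (2 * n)) 𝓘(ℝ, 𝕎 n) (homLift (chartIndex p)) p (liftCLM (chartIndex p)) := by
  refine ⟨(contMDiffAt_homLift (coordNeZero_chartIndex p)).continuousAt, ?_⟩
  have hw : writtenInExtChartAt (𝓡 (2 * n)) 𝓘(ℝ, 𝕎 n) p (homLift (chartIndex p)) =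
      affLift (chartIndex p) := by
    funext w
    simp only [writtenInExtChartAt, Function.comp_apply, extChartAt_model_space_eq_id,
      PartialEquiv.refl_coe, id_eq, extChartAt_coe_symm, modelWithCornersSelf_coe_symm,
      CompTriple.comp_eq, chartAt_eq, homLift_affineChart_symm]
  rw [hw]
  exact (hasFDerivAt_affLift _ _).hasFDerivWithinAt

/-- The differential of the preferred lift, evaluated: `d(homLift i)_p v = Lᵢ v`, `i = chartIndex p`.
[folklore] -/
theorem mvfderiv_homLift_apply (p : ComplexProjectiveSpace n) (v : TangentSpace (𝓡 (2 * n)) p) :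
    mvfderiv (𝓡 (2 * n)) (homLift (chartIndex p)) p v = liftCLM (chartIndex p) v :=
  congrArg (fun L : TangentSpace (𝓡 (2 * n)) p →L[ℝ] TangentSpace 𝓘(ℝ, 𝕎 n) _ ↦
    (show 𝕎 n from L v)) (hasMFDerivAt_homLift p).mfderiv


/-! ### The class map `toCP` is smooth off the origin -/

/-- `toCP` is continuous at every nonzero vector (it is `mk` on the open set `{v ≠ 0}`). [folklore] -/
theorem continuousAt_toCP {v : 𝕎 n} (hv : v ≠ 0) : ContinuousAt (toCP (n := n)) v := by
  have hv' : WithLp.ofLp v ≠ 0 := fun h ↦ hv ((ofLp_eq_zero_iff v).1 h)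
  have ho : IsOpen {u : 𝕎 n | WithLp.ofLp u ≠ 0} :=
    isOpen_ne_fun (PiLp.continuous_ofLp 2 _) continuous_const
  have hc : ContinuousOn (toCP (n := n)) {u : 𝕎 n | WithLp.ofLp u ≠ 0} := by
    rw [continuousOn_iff_continuous_restrict]
    have h : ({u : 𝕎 n | WithLp.ofLp u ≠ 0}).restrict (toCP (n := n)) =
        fun u : {u : 𝕎 n | WithLp.ofLp u ≠ 0} ↦ ComplexProjectiveSpace.mk ⟨WithLp.ofLp u.1, u.2⟩ := by
      funext u
      exact toCP_of_ne_zero u.2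
    rw [h]
    exact continuous_mk.comp (((PiLp.continuous_ofLp 2 _).comp continuous_subtype_val).subtype_mk _)
  exact hc.continuousAt (ho.mem_nhds hv')

/-- In the affine chart `k`, the class map reads `u ↦ (u_{k⁺(j)} / u_k)ⱼ` (realified) near every
vector with `u_k ≠ 0`. [folklore] -/
theorem affineChart_toCP_eventuallyEq {v : 𝕎 n} {k : Fin (n + 1)} (hk : v k ≠ 0) :
    (fun u ↦ affineChart k (toCP u)) =ᶠ[𝓝 v]
      fun u : 𝕎 n ↦ realCoordinates n (fun j ↦ u (k.succAbove j) / u k) := by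
  have ho : IsOpen {u : 𝕎 n | u k ≠ 0} :=
    isOpen_ne_fun (EuclideanSpace.proj (𝕜 := ℂ) k).continuous continuous_const
  filter_upwards [ho.mem_nhds hk] with u hu
  have hu0 : WithLp.ofLp u ≠ 0 := fun h ↦ hu (by simpa using congr_fun h k)
  rw [affineChart_apply, toCP_of_ne_zero hu0, affineCoord, Function.comp_apply, affineCoordComplex_mk]

/-- The chart expression `u ↦ (u_{k⁺(j)} / u_k)ⱼ` (realified) is real `C^∞` where `u_k ≠ 0`
(a rational map). [folklore] -/
theorem contDiffAt_affineRatio {v : 𝕎 n} {k : Fin (n + 1)} (hk : v k ≠ 0) :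
    ContDiffAt ℝ ∞ (fun u : 𝕎 n ↦ realCoordinates n (fun j ↦ u (k.succAbove j) / u k)) v := by
  refine (realCoordinates n).contDiff.contDiffAt.comp v ?_
  have hC : ContDiffAt ℂ ∞ (fun u : 𝕎 n ↦ fun j ↦ u (k.succAbove j) / u k) v := by
    refine contDiffAt_pi.2 fun j ↦ ?_
    exact ((EuclideanSpace.proj (𝕜 := ℂ) (k.succAbove j)).contDiff.contDiffAt).div
      ((EuclideanSpace.proj (𝕜 := ℂ) k).contDiff.contDiffAt) hk
  exact hC.restrict_scalars ℝ

/-- **The class map `v ↦ [v]` is `C^∞` off the origin** (in the affine chart `k = chartIndex [v]`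
it is the rational map `u ↦ (u_{k⁺(j)} / u_k)ⱼ`; Griffiths–Harris, Ch. 0 §2).
[cite: GriffithsHarrisPrinciples1978, Ch. 0 §2] -/
theorem contMDiffAt_toCP {v : 𝕎 n} (hv : v ≠ 0) :
    ContMDiffAt 𝓘(ℝ, 𝕎 n) (𝓡 (2 * n)) ∞ (toCP (n := n)) v := by
  rw [contMDiffAt_iff_target]
  refine ⟨continuousAt_toCP hv, ?_⟩
  have hk : v (chartIndex (toCP v)) ≠ 0 :=
    (coordNeZero_toCP_iff hv _).1 (coordNeZero_chartIndex _)
  have hev : (extChartAt (𝓡 (2 * n)) (toCP v) ∘ toCP) =ᶠ[𝓝 v]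
      fun u : 𝕎 n ↦ realCoordinates n
        (fun j ↦ u ((chartIndex (toCP v)).succAbove j) / u (chartIndex (toCP v))) := by
    filter_upwards [affineChart_toCP_eventuallyEq hk] with u hu
    rw [Function.comp_apply, extChartAt_coe, Function.comp_apply, modelWithCornersSelf_coe, id_eq,
      chartAt_eq]
    exact hu
  exact (contDiffAt_affineRatio hk).contMDiffAt.congr_of_eventuallyEq hev

/-- The class map `v ↦ [v]` is differentiable off the origin. [folklore] -/
theorem mdifferentiableAt_toCP {v : 𝕎 n} (hv : v ≠ 0) :
    MDifferentiableAt 𝓘(ℝ, 𝕎 n) (𝓡 (2 * n)) (toCP (n := n)) v :=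
  (contMDiffAt_toCP hv).mdifferentiableAt (by simp)

/-! ## Part 3. The Fubini–Study form of `ℂℙⁿ` -/

variable (n) in
/-- **The Fubini–Study symplectic form of `ℂℙⁿ`**, as a real `2`-form on the `2n`-manifold
`ComplexProjectiveSpace n`: at `p`, the pull-back of the lifted Fubini–Study form `β₀ = dα₀` of
`ℂⁿ⁺¹ ∖ {0}` (`fubiniStudyForm`, normalisation `β₀ = 2 Im h_FS`) along the canonical section
`homLift (chartIndex p) : [v] ↦ v / vᵢ` of the preferred affine chart. Independent of the section
(`fubiniStudyMFormCP_eq_pullback_homLift`), smooth, closed, of type `(1,1)`, positive and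
nondegenerate (below). McDuff–Salamon (2017), Example 4.3.3 (`ρ_FS = pr^*ω_FS` "descends to a
symplectic form on `ℂPⁿ` … called the Fubini–Study form"); Griffiths–Harris, Ch. 0 §2; Voisin
(2002), §3.3.2. Normalisation: `fubiniStudyMFormCP n = 2 ω_FS^{MS} = 2π · (i/2π)∂∂̄ log ‖Z‖²`
(McDuff–Salamon's `α_FS` of Exercise 4.3.4 (i) is `α₀/2`; their lines have area `π`, ours `2π`).
[cite: McDuffSalamon2017, Example 4.3.3] -/
def fubiniStudyMFormCP : MForm (𝓡 (2 * n)) (ComplexProjectiveSpace n) ℝ 2 := fun p ↦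
  (fubiniStudyMForm (W := 𝕎 n)).pullback (𝓡 (2 * n)) (homLift (chartIndex p)) p

/-- Unfolding of `fubiniStudyMFormCP` at a point (definitional). [folklore] -/
theorem fubiniStudyMFormCP_def (p : ComplexProjectiveSpace n) :
    fubiniStudyMFormCP n p =
      (fubiniStudyMForm (W := 𝕎 n)).pullback (𝓡 (2 * n)) (homLift (chartIndex p)) p :=
  rfl

/-- Evaluation of `ω_FS` through the preferred lift:
`ω_FS(p)(v₀, v₁) = β₀(homLift i p)(d(homLift i)_p v₀, d(homLift i)_p v₁)`, `i = chartIndex p`.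
[cite: GriffithsHarrisPrinciples1978, Ch. 0 §2] -/
theorem fubiniStudyMFormCP_apply (p : ComplexProjectiveSpace n)
    (v : Fin 2 → TangentSpace (𝓡 (2 * n)) p) :
    fubiniStudyMFormCP n p v =
      fubiniStudyForm (homLift (chartIndex p) p)
        ![mvfderiv (𝓡 (2 * n)) (homLift (chartIndex p)) p (v 0),
          mvfderiv (𝓡 (2 * n)) (homLift (chartIndex p)) p (v 1)] :=
  fubiniStudyMForm_pullback_apply _ _ _

/-- **`ω_FS` explicitly**: `ω_FS(p)(v, w) = β₀(homLift i p)(Lᵢ v, Lᵢ w)` with `i = chartIndex p` and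
`Lᵢ = liftCLM i` (so that, by `fubiniStudyForm_apply`, `ω_FS` is the familiar rational expression
in the affine coordinates). [cite: GriffithsHarrisPrinciples1978, Ch. 0 §2] -/
theorem fubiniStudyMFormCP_apply_pair (p : ComplexProjectiveSpace n)
    (v w : TangentSpace (𝓡 (2 * n)) p) :
    fubiniStudyMFormCP n p ![v, w] =
      fubiniStudyForm (homLift (chartIndex p) p) ![liftCLM (chartIndex p) v, liftCLM (chartIndex p) w] := by
  rw [fubiniStudyMFormCP_apply, mvfderiv_homLift_apply, mvfderiv_homLift_apply]
  rfl

/-! ### Independence of the section -/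

/-- On `Uᵢ ∩ U_k` the `i`-th coordinate of `homLift k p` is nonzero. [folklore] -/
theorem homLift_apply_ne_zero {i k : Fin (n + 1)} {p : ComplexProjectiveSpace n}
    (hi : CoordNeZero i p) (hk : CoordNeZero k p) : homLift k p i ≠ 0 := by
  induction p using ind with
  | h v =>
    have hvi : (v : Fin (n + 1) → ℂ) i ≠ 0 := (coordNeZero_mk i v).1 hi
    have hvk : (v : Fin (n + 1) → ℂ) k ≠ 0 := (coordNeZero_mk k v).1 hk
    simpa using div_ne_zero hvi hvk

/-- The transition coefficient `q ↦ ((homLift k q)ᵢ)⁻¹` is differentiable at the points of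
`Uᵢ ∩ U_k`. [folklore] -/
theorem mdifferentiableAt_inv_homLift_apply {i k : Fin (n + 1)} {p : ComplexProjectiveSpace n}
    (hi : CoordNeZero i p) (hk : CoordNeZero k p) :
    MDifferentiableAt (𝓡 (2 * n)) 𝓘(ℝ, ℂ) (fun q ↦ ((homLift k q) i)⁻¹) p := by
  have h1 : ContDiffAt ℝ ∞ (fun u : 𝕎 n ↦ (u i)⁻¹) (homLift k p) :=
    (((EuclideanSpace.proj (𝕜 := ℂ) i).contDiff.restrict_scalars ℝ).contDiffAt).inv
      (homLift_apply_ne_zero hi hk)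
  exact (h1.contMDiffAt.comp p (contMDiffAt_homLift hk)).mdifferentiableAt (by simp)

/-- Near a point of `Uᵢ ∩ U_k`, `homLift i = ((homLift k)ᵢ)⁻¹ • homLift k`. [folklore] -/
theorem homLift_eventuallyEq_inv_smul {i k : Fin (n + 1)} {p : ComplexProjectiveSpace n}
    (hi : CoordNeZero i p) (hk : CoordNeZero k p) :
    homLift i =ᶠ[𝓝 p] fun q ↦ ((homLift k q) i)⁻¹ • homLift k q := by
  filter_upwards [(isOpen_setOf_coordNeZero i).mem_nhds hi,
    (isOpen_setOf_coordNeZero k).mem_nhds hk] with q hqi hqk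
  exact homLift_eq_inv_smul hqi hqk

/-- **`ω_FS` does not depend on the section used to define it**: for every affine open set
`U_k ∋ p`, `ω_FS(p) = ((homLift k)^* β₀)(p)`. The two sections differ by the unit
`f = ((homLift k)ᵢ)⁻¹`, and `(fG)^*β₀ = G^*β₀` by the product rule and projective invariance of `β₀`
(Griffiths–Harris, Ch. 0 §2: `(i/2π)∂∂̄ log ‖Z‖²` is independent of the lifting `Z` chosen, hence a
globally defined form on `ℙⁿ`; Voisin (2002), §3.3.1: the local forms "coincide on `Uᵢ ∩ Uⱼ`").
[cite: GriffithsHarrisPrinciples1978, Ch. 0 §2] -/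
theorem fubiniStudyMFormCP_eq_pullback_homLift {k : Fin (n + 1)} {p : ComplexProjectiveSpace n}
    (hk : CoordNeZero k p) :
    fubiniStudyMFormCP n p = (fubiniStudyMForm (W := 𝕎 n)).pullback (𝓡 (2 * n)) (homLift k) p := by
  have hi : CoordNeZero (chartIndex p) p := coordNeZero_chartIndex p
  ext v
  rw [fubiniStudyMFormCP_apply, fubiniStudyMForm_pullback_apply,
    mvfderiv_congr_of_eventuallyEq' (homLift_eventuallyEq_inv_smul hi hk),
    homLift_eq_inv_smul hi hk]
  exact fubiniStudyForm_mvfderiv_smul (mdifferentiableAt_inv_homLift_apply hi hk)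
    (mdifferentiableAt_homLift hk) (inv_ne_zero (homLift_apply_ne_zero hi hk))
    (homLift_ne_zero hk) _ _

/-- Evaluation of `ω_FS` through any affine lift containing the point:
`ω_FS(p)(v₀, v₁) = β₀(homLift k p)(d(homLift k)_p v₀, d(homLift k)_p v₁)` for `p ∈ U_k`.
[cite: GriffithsHarrisPrinciples1978, Ch. 0 §2] -/
theorem fubiniStudyMFormCP_apply_of_coordNeZero {k : Fin (n + 1)} {p : ComplexProjectiveSpace n}
    (hk : CoordNeZero k p) (v : Fin 2 → TangentSpace (𝓡 (2 * n)) p) :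
    fubiniStudyMFormCP n p v =
      fubiniStudyForm (homLift k p)
        ![mvfderiv (𝓡 (2 * n)) (homLift k) p (v 0), mvfderiv (𝓡 (2 * n)) (homLift k) p (v 1)] := by
  rw [fubiniStudyMFormCP_eq_pullback_homLift hk, fubiniStudyMForm_pullback_apply]

/-- Near `p ∈ U_k`, `ω_FS` is the pull-back `(homLift k)^* β₀` (as a germ of forms). [folklore] -/
theorem fubiniStudyMFormCP_eventuallyEq_pullback {k : Fin (n + 1)} {p : ComplexProjectiveSpace n}
    (hk : CoordNeZero k p) :
    ∀ᶠ q in 𝓝 p,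
      (fubiniStudyMForm (W := 𝕎 n)).pullback (𝓡 (2 * n)) (homLift k) q = fubiniStudyMFormCP n q := by
  filter_upwards [(isOpen_setOf_coordNeZero k).mem_nhds hk] with q hq
  exact (fubiniStudyMFormCP_eq_pullback_homLift hq).symm

/-! ### Smoothness and closedness -/

/-- The lifted Fubini–Study form is smooth (as a form on the manifold `ℂⁿ⁺¹`) off the origin.
[cite: VoisinHodgeI2002, §3.3.2 Lemma 3.16] -/
theorem smoothAt_fubiniStudyMForm {Z : 𝕎 n} (hZ : Z ≠ 0) :
    (fubiniStudyMForm (W := 𝕎 n)).SmoothAt Z :=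
  (MForm.smoothAt_model_iff _ _).2 (contDiffAt_fubiniStudyForm hZ)

/-- `ω_FS` is smooth at every point: near `p` it is the pull-back of the `C^∞` form `β₀` along the
`C^∞` section `homLift (chartIndex p)` (Warner 2.22, `MForm.SmoothAt.pullback`).
[cite: GriffithsHarrisPrinciples1978, Ch. 0 §2] -/
theorem smoothAt_fubiniStudyMFormCP (p : ComplexProjectiveSpace n) :
    (fubiniStudyMFormCP n).SmoothAt p := by
  have hk : CoordNeZero (chartIndex p) p := coordNeZero_chartIndex p
  exact (MForm.SmoothAt.pullback (eventually_contMDiffAt_homLift hk)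
    (smoothAt_fubiniStudyMForm (homLift_ne_zero hk))).congr_of_eventuallyEq
    (fubiniStudyMFormCP_eventuallyEq_pullback hk)

/-- **`ω_FS` is a smooth `2`-form on `ℂℙⁿ`.** [cite: GriffithsHarrisPrinciples1978, Ch. 0 §2] -/
theorem isSmoothForm_fubiniStudyMFormCP : IsSmoothForm (fubiniStudyMFormCP n) := fun p ↦
  smoothAt_fubiniStudyMFormCP p

/-- `dω_FS = 0` at every point: `d((homLift k)^*β₀) = (homLift k)^*(dβ₀) = 0` (naturality of `d`,
Warner 2.23, and `dβ₀ = ddα₀ = 0`). [cite: GriffithsHarrisPrinciples1978, Ch. 0 §2] -/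
theorem mextDeriv_fubiniStudyMFormCP_apply (p : ComplexProjectiveSpace n) :
    mextDeriv (fubiniStudyMFormCP n) p = 0 := by
  have hk : CoordNeZero (chartIndex p) p := coordNeZero_chartIndex p
  have h0 : homLift (chartIndex p) p ≠ 0 := homLift_ne_zero hk
  have hd : mextDeriv (fubiniStudyMForm (W := 𝕎 n)) (homLift (chartIndex p) p) = 0 := by
    rw [mextDeriv_eq_extDeriv]
    exact extDeriv_fubiniStudyForm h0
  rw [← mextDeriv_congr_of_eventuallyEq (fubiniStudyMFormCP_eventuallyEq_pullback hk),
    mextDeriv_pullback_apply (eventually_contMDiffAt_homLift hk) (smoothAt_fubiniStudyMForm h0)]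
  ext v
  simp [MForm.pullback_apply, hd]

/-- **`ω_FS` is closed** (`dω_FS = 0`; McDuff–Salamon (2017), Example 4.3.3: "Hence `ω_FS` is
closed"; Griffiths–Harris, Ch. 0 §2). [cite: McDuffSalamon2017, Example 4.3.3] -/
theorem isClosedForm_fubiniStudyMFormCP : IsClosedForm (fubiniStudyMFormCP n) :=
  funext mextDeriv_fubiniStudyMFormCP_apply

/-- `ω_FS` is a closed smooth form (membership in `closedSmoothForms`, the input of the de Rham /
Kähler-class constructions). [cite: GriffithsHarrisPrinciples1978, Ch. 0 §2] -/
theorem fubiniStudyMFormCP_mem_closedSmoothForms :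
    fubiniStudyMFormCP n ∈ closedSmoothForms (𝓡 (2 * n)) (ComplexProjectiveSpace n) ℝ 2 :=
  ⟨isSmoothForm_fubiniStudyMFormCP, isClosedForm_fubiniStudyMFormCP⟩

/-! ### The complex structure, type `(1,1)`, positivity, nondegeneracy -/

variable (n) in
/-- **The standard complex structure `J₀` on the real model space `ℝ²ⁿ` of `ℂℙⁿ`**:
multiplication by `i` on `ℂⁿ`, read through `realCoordinates`. Since the affine atlas of `ℂℙⁿ`
is holomorphic (transition maps `(z_j/z_i)_j ↦ (z_j/z_k)_j`), this is the complex structure of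
`T_p ℂℙⁿ` in the identification `T_p ℂℙⁿ = ℝ²ⁿ` through the preferred chart at `p`, for every
`p` (McDuff–Salamon (2017), Example 4.3.3: "The complex structure is multiplication by `i` under this
identification … the transition maps `φ_k ∘ φ_j⁻¹` are holomorphic"). [cite: McDuffSalamon2017, Example 4.3.3] -/
def stdJ : 𝔼 (2 * n) →L[ℝ] 𝔼 (2 * n) :=
  ((realCoordinates n : (Fin n → ℂ) →L[ℝ] 𝔼 (2 * n)).comp
    (I • ContinuousLinearMap.id ℝ (Fin n → ℂ))).comp
    ((realCoordinates n).symm : 𝔼 (2 * n) →L[ℝ] (Fin n → ℂ))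

/-- Unfolding of `stdJ`: `J₀ v = realCoordinates (i • realCoordinates⁻¹ v)`. [folklore] -/
theorem stdJ_apply (v : 𝔼 (2 * n)) :
    stdJ n v = realCoordinates n (I • (realCoordinates n).symm v) :=
  rfl

/-- `J₀² = -1`. [folklore] -/
theorem stdJ_stdJ (v : 𝔼 (2 * n)) : stdJ n (stdJ n v) = -v := by
  rw [stdJ_apply, stdJ_apply, ContinuousLinearEquiv.symm_apply_apply, smul_smul, I_mul_I,
    neg_one_smul, map_neg, ContinuousLinearEquiv.apply_symm_apply]

/-- **The differential of the section is `ℂ`-linear**: `Lᵢ (J₀ v) = i • Lᵢ v`. [folklore] -/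
theorem liftCLM_stdJ (i : Fin (n + 1)) (v : 𝔼 (2 * n)) :
    liftCLM i (stdJ n v) = I • liftCLM i v := by
  rw [liftCLM_apply, liftCLM_apply, stdJ_apply, ContinuousLinearEquiv.symm_apply_apply,
    insertNth_zero_smul, WithLp.toLp_smul]

/-- **`ω_FS` is of type `(1,1)`**: `ω_FS(J₀ v, J₀ w) = ω_FS(v, w)` (Voisin (2002), §3.3.2:
`ω` is a real `(1,1)`-form; Griffiths–Harris, Ch. 0 §2). [cite: VoisinHodgeI2002, §3.3.2 Lemma 3.16] -/
theorem fubiniStudyMFormCP_stdJ (p : ComplexProjectiveSpace n) (v w : TangentSpace (𝓡 (2 * n)) p) :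
    fubiniStudyMFormCP n p ![stdJ n v, stdJ n w] = fubiniStudyMFormCP n p ![v, w] := by
  rw [fubiniStudyMFormCP_apply_pair, fubiniStudyMFormCP_apply_pair, liftCLM_stdJ, liftCLM_stdJ]
  exact fubiniStudyForm_I_smul (homLift_ne_zero (coordNeZero_chartIndex p)) _ _

/-- `ω_FS(v, J₀ v) ≥ 0`. [cite: VoisinHodgeI2002, §3.3.2 Lemma 3.16] -/
theorem fubiniStudyMFormCP_self_stdJ_nonneg (p : ComplexProjectiveSpace n)
    (v : TangentSpace (𝓡 (2 * n)) p) : 0 ≤ fubiniStudyMFormCP n p ![v, stdJ n v] := by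
  rw [fubiniStudyMFormCP_apply_pair, liftCLM_stdJ]
  exact fubiniStudyForm_self_I_smul_nonneg (homLift_ne_zero (coordNeZero_chartIndex p)) _

/-- **`ω_FS` is positive (`J₀`-tame)**: `ω_FS(v, J₀ v) > 0` for `v ≠ 0` — the Fubini–Study form is
the Kähler form of a metric (Voisin (2002), §3.3.2, Lemma 3.16: "the form `ω` defined this way on
`ℙⁿ(ℂ)` is positive"; McDuff–Salamon (2017), §4.3). If `β₀(Z)(Lᵢv, iLᵢv) = 0` then `Lᵢ v ∈ ℂ Z`
(`Z = homLift i p`, `Zᵢ = 1`, `(Lᵢ v)ᵢ = 0`), forcing `Lᵢ v = 0`, i.e. `v = 0`.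
[cite: VoisinHodgeI2002, §3.3.2 Lemma 3.16] -/
theorem fubiniStudyMFormCP_self_stdJ_pos (p : ComplexProjectiveSpace n)
    {v : TangentSpace (𝓡 (2 * n)) p} (hv : v ≠ 0) : 0 < fubiniStudyMFormCP n p ![v, stdJ n v] := by
  have hk : CoordNeZero (chartIndex p) p := coordNeZero_chartIndex p
  have hZ : homLift (chartIndex p) p ≠ 0 := homLift_ne_zero hk
  rw [fubiniStudyMFormCP_apply_pair, liftCLM_stdJ]
  refine lt_of_le_of_ne (fubiniStudyForm_self_I_smul_nonneg hZ _) (fun h ↦ hv ?_)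
  obtain ⟨r, hr⟩ := exists_eq_smul_of_fubiniStudyForm_self_I_smul_eq_zero hZ h.symm
  have hr0 : r = 0 := by
    have h1 := congrArg (fun u : 𝕎 n ↦ u (chartIndex p)) hr
    simp only [liftCLM_apply_same, PiLp.smul_apply, homLift_apply_same hk, smul_eq_mul,
      mul_one] at h1
    exact h1.symm
  rw [hr0, zero_smul] at hr
  exact liftCLM_injective _ (hr.trans (map_zero _).symm)

/-- **`ω_FS` is nondegenerate**: every `v ≠ 0` pairs non-trivially with `J₀ v`. Together with
`isSmoothForm_fubiniStudyMFormCP` and `isClosedForm_fubiniStudyMFormCP`: `(ℂℙⁿ, ω_FS)` is a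
symplectic manifold (McDuff–Salamon (2017), Example 4.3.3). [cite: McDuffSalamon2017, Example 4.3.3] -/
theorem fubiniStudyMFormCP_nondegenerate (p : ComplexProjectiveSpace n)
    {v : TangentSpace (𝓡 (2 * n)) p} (hv : v ≠ 0) :
    ∃ w : TangentSpace (𝓡 (2 * n)) p, fubiniStudyMFormCP n p ![v, w] ≠ 0 :=
  ⟨stdJ n v, (fubiniStudyMFormCP_self_stdJ_pos p hv).ne'⟩

/-! ### The universal property: pull-backs along maps `[G] : N → ℂℙⁿ` -/

variable {EN : Type*} [NormedAddCommGroup EN] [NormedSpace ℝ EN]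
  {HN : Type*} [TopologicalSpace HN] {IN : ModelWithCorners ℝ EN HN}
  {N : Type*} [TopologicalSpace N] [ChartedSpace HN N]

/-- **Chain formula.** For a map `F : N → ℂℙⁿ` of a real manifold differentiable at `x`,
`(F^*ω_FS)(x)(v₀, v₁) = β₀(homLift i (F x))(d(homLift i ∘ F)_x v₀, d(homLift i ∘ F)_x v₁)` with
`i = chartIndex (F x)`: the right-hand side involves `F x` only through maps into fixed spaces.
[folklore] -/
theorem fubiniStudyMFormCP_pullback_apply {F : N → ComplexProjectiveSpace n} {x : N}
    (hF : MDifferentiableAt IN (𝓡 (2 * n)) F x) (v : Fin 2 → TangentSpace IN x) :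
    (fubiniStudyMFormCP n).pullback IN F x v =
      fubiniStudyForm (homLift (chartIndex (F x)) (F x))
        ![mvfderiv IN (homLift (chartIndex (F x)) ∘ F) x (v 0),
          mvfderiv IN (homLift (chartIndex (F x)) ∘ F) x (v 1)] := by
  have hc : ∀ u : TangentSpace IN x, mvfderiv IN (homLift (chartIndex (F x)) ∘ F) x u =
      mvfderiv (𝓡 (2 * n)) (homLift (chartIndex (F x))) (F x) (mfderiv IN (𝓡 (2 * n)) F x u) := by
    intro u
    have h := mfderiv_comp x (mdifferentiableAt_homLift (coordNeZero_chartIndex (F x))) hF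
    exact congrArg (fun L : TangentSpace IN x →L[ℝ] TangentSpace 𝓘(ℝ, 𝕎 n) _ ↦
      (show 𝕎 n from L u)) h
  rw [hc, hc, MForm.pullback_apply, fubiniStudyMFormCP_apply]

/-- `F^*ω_FS` at `x` only depends on the germ of `F` at `x`. [folklore] -/
theorem fubiniStudyMFormCP_pullback_congr_of_eventuallyEq {F F' : N → ComplexProjectiveSpace n}
    {x : N} (hF : MDifferentiableAt IN (𝓡 (2 * n)) F x) (h : F =ᶠ[𝓝 x] F') :
    (fubiniStudyMFormCP n).pullback IN F x = (fubiniStudyMFormCP n).pullback IN F' x := by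
  have hF' : MDifferentiableAt IN (𝓡 (2 * n)) F' x := hF.congr_of_eventuallyEq h.symm
  have hx : F x = F' x := h.self_of_nhds
  have hc : (homLift (chartIndex (F' x)) ∘ F) =ᶠ[𝓝 x] (homLift (chartIndex (F' x)) ∘ F') :=
    h.fun_comp _
  ext v
  rw [fubiniStudyMFormCP_pullback_apply hF, fubiniStudyMFormCP_pullback_apply hF', hx,
    mvfderiv_congr_of_eventuallyEq' hc]

/-- **Universal property of `ω_FS`.** For every map `G : N → ℂⁿ⁺¹` of a real manifold,
differentiable at `x` with `G x ≠ 0`, the pull-back of `ω_FS` along the induced map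
`[G] = toCP ∘ G : N → ℂℙⁿ` is the pull-back of the lifted form: `([G])^* ω_FS = G^* β₀` at `x`.
(Near `x`, `homLift i ∘ [G] = G_i⁻¹ • G`, and `(fG)^*β₀ = G^*β₀`.) This is the statement that `β₀`
on `ℂⁿ⁺¹ ∖ {0}` is the pull-back of `ω_FS` under `π : ℂⁿ⁺¹ ∖ {0} → ℂℙⁿ` (Griffiths–Harris, Ch. 0 §2,
`π^*ω = (i/2π)∂∂̄ log ‖Z‖²`), composed with `G`. [cite: GriffithsHarrisPrinciples1978, Ch. 0 §2] -/
theorem fubiniStudyMFormCP_pullback_toCP_comp {G : N → 𝕎 n} {x : N}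
    (hG : MDifferentiableAt IN 𝓘(ℝ, 𝕎 n) G x) (h0 : G x ≠ 0) :
    (fubiniStudyMFormCP n).pullback IN (toCP ∘ G) x =
      (fubiniStudyMForm (W := 𝕎 n)).pullback IN G x := by
  have hF : MDifferentiableAt IN (𝓡 (2 * n)) (toCP ∘ G) x := (mdifferentiableAt_toCP h0).comp x hG
  set k := chartIndex (toCP (G x)) with hk_def
  have hk : G x k ≠ 0 := (coordNeZero_toCP_iff h0 k).1 (coordNeZero_chartIndex _)
  have hev : (homLift k ∘ (toCP ∘ G)) =ᶠ[𝓝 x] fun y ↦ ((G y) k)⁻¹ • G y := by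
    have ho : IsOpen {u : 𝕎 n | u k ≠ 0} :=
      isOpen_ne_fun (EuclideanSpace.proj (𝕜 := ℂ) k).continuous continuous_const
    filter_upwards [hG.continuousAt.preimage_mem_nhds (ho.mem_nhds hk)] with y hy
    exact homLift_toCP hy
  have hf : MDifferentiableAt IN 𝓘(ℝ, ℂ) (fun y ↦ ((G y) k)⁻¹) x := by
    have h1 : ContDiffAt ℝ ∞ (fun u : 𝕎 n ↦ (u k)⁻¹) (G x) :=
      (((EuclideanSpace.proj (𝕜 := ℂ) k).contDiff.restrict_scalars ℝ).contDiffAt).inv hk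
    exact (h1.contMDiffAt.mdifferentiableAt (by simp)).comp x hG
  ext v
  rw [fubiniStudyMFormCP_pullback_apply hF]
  simp only [Function.comp_apply, ← hk_def]
  rw [mvfderiv_congr_of_eventuallyEq' hev, homLift_toCP hk, fubiniStudyMForm_pullback_apply]
  exact fubiniStudyForm_mvfderiv_smul hf hG (inv_ne_zero hk) h0 _ _

/-- **`pr^* ω_FS = β₀`**: the pull-back of `ω_FS` along the class map `toCP : ℂⁿ⁺¹ ∖ {0} → ℂℙⁿ` is
the lifted Fubini–Study form, at every nonzero vector (McDuff–Salamon (2017), Example 4.3.3: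
"`ρ_FS = pr^*ω_FS`", in the normalisation `β₀ = 2ρ_FS`). [cite: McDuffSalamon2017, Example 4.3.3] -/
theorem fubiniStudyMFormCP_pullback_toCP {v : 𝕎 n} (hv : v ≠ 0) :
    (fubiniStudyMFormCP n).pullback 𝓘(ℝ, 𝕎 n) toCP v = fubiniStudyMForm (W := 𝕎 n) v := by
  have h := fubiniStudyMFormCP_pullback_toCP_comp (IN := 𝓘(ℝ, 𝕎 n)) (G := id)
    mdifferentiableAt_id hv
  rwa [MForm.pullback_id] at h

/-! ### Invariance under maps of `ℂℙⁿ` with (anti-)unitary lifts -/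

/-- A map preserving (or conjugating) Hermitian products preserves norms, hence is injective on
nonzero vectors. [folklore] -/
theorem norm_map_of_re_inner_map_eq {W : Type*} [NormedAddCommGroup W] [InnerProductSpace ℂ W]
    (A : W →L[ℝ] W) (hA : ∀ a : W, (⟪A a, A a⟫_ℂ).re = (⟪a, a⟫_ℂ).re) (u : W) : ‖A u‖ = ‖u‖ := by
  rw [← pow_left_inj₀ (norm_nonneg _) (norm_nonneg _) two_ne_zero]
  have h1 := hA u
  rw [inner_self_eq_norm_sq_to_K, inner_self_eq_norm_sq_to_K] at h1
  exact_mod_cast h1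

/-- **`ω_FS` is invariant under every self-map of `ℂℙⁿ` that lifts to a map of `ℂⁿ⁺¹` preserving
the Hermitian product** (the projective unitary group `PU(n+1)`; Griffiths–Harris, Ch. 0 §2: `U(n+1)`
acts transitively on `ℙⁿ` leaving `ω` invariant): if
`Φ [v] = [A v]` for `v ≠ 0` and `⟪Aa, Ab⟫ = ⟪a, b⟫`, then `Φ^* ω_FS = ω_FS` (McDuff–Salamon (2017),
Exercise 5.1.3: "`ω_FS` is `U(n+1)`-invariant"). [cite: McDuffSalamon2017, Exercise 5.1.3] -/
theorem fubiniStudyMFormCP_pullback_eq_of_lift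
    {Φ : ComplexProjectiveSpace n → ComplexProjectiveSpace n}
    (A : 𝕎 n →L[ℝ] 𝕎 n) (hA : ∀ a b : 𝕎 n, ⟪A a, A b⟫_ℂ = ⟪a, b⟫_ℂ)
    (hΦ : ∀ v : 𝕎 n, v ≠ 0 → Φ (toCP v) = toCP (A v)) :
    (fubiniStudyMFormCP n).pullback (𝓡 (2 * n)) Φ = fubiniStudyMFormCP n := by
  have hn : ∀ u, ‖A u‖ = ‖u‖ :=
    norm_map_of_re_inner_map_eq A (fun a ↦ by rw [hA])
  have hA0 : ∀ u : 𝕎 n, u ≠ 0 → A u ≠ 0 := fun u hu h ↦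
    hu (by rw [← norm_eq_zero, ← hn, h, norm_zero])
  funext p
  have hk : CoordNeZero (chartIndex p) p := coordNeZero_chartIndex p
  have hZ : homLift (chartIndex p) p ≠ 0 := homLift_ne_zero hk
  have hev : Φ =ᶠ[𝓝 p] (toCP ∘ (A ∘ homLift (chartIndex p))) := by
    filter_upwards [(isOpen_setOf_coordNeZero (chartIndex p)).mem_nhds hk] with q hq
    rw [Function.comp_apply, Function.comp_apply, ← hΦ _ (homLift_ne_zero hq), toCP_homLift hq]
  have hG : MDifferentiableAt (𝓡 (2 * n)) 𝓘(ℝ, 𝕎 n) (A ∘ homLift (chartIndex p)) p :=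
    A.hasMFDerivAt.mdifferentiableAt.comp p (mdifferentiableAt_homLift hk)
  have hF : MDifferentiableAt (𝓡 (2 * n)) (𝓡 (2 * n)) (toCP ∘ (A ∘ homLift (chartIndex p))) p :=
    (mdifferentiableAt_toCP (hA0 _ hZ)).comp p hG
  have hΦd : MDifferentiableAt (𝓡 (2 * n)) (𝓡 (2 * n)) Φ p := hF.congr_of_eventuallyEq hev
  rw [fubiniStudyMFormCP_pullback_congr_of_eventuallyEq hΦd hev,
    fubiniStudyMFormCP_pullback_toCP_comp hG (hA0 _ hZ)]
  ext v
  rw [fubiniStudyMForm_pullback_apply, Function.comp_apply,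
    mvfderiv_clm_comp_apply A (mdifferentiableAt_homLift hk),
    mvfderiv_clm_comp_apply A (mdifferentiableAt_homLift hk),
    fubiniStudyForm_of_inner_map_eq A hA hZ, fubiniStudyMFormCP_apply]

/-- **`ω_FS` is anti-invariant under every self-map of `ℂℙⁿ` that lifts to a map of `ℂⁿ⁺¹`
conjugating the Hermitian product** (anti-unitary lifts: complex conjugation, or the quaternionic
real structure `τ₀[z₀:z₁:…] = [-z̄₁ : z̄₀ : …]` of `ℂℙ²ᵏ⁺¹`): if `Φ [v] = [A v]` for `v ≠ 0` and
`⟪Aa, Ab⟫ = conj ⟪a, b⟫`, then `Φ^* ω_FS = -ω_FS`. [folklore] -/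
theorem fubiniStudyMFormCP_pullback_eq_neg_of_lift
    {Φ : ComplexProjectiveSpace n → ComplexProjectiveSpace n}
    (A : 𝕎 n →L[ℝ] 𝕎 n) (hA : ∀ a b : 𝕎 n, ⟪A a, A b⟫_ℂ = conj ⟪a, b⟫_ℂ)
    (hΦ : ∀ v : 𝕎 n, v ≠ 0 → Φ (toCP v) = toCP (A v)) :
    (fubiniStudyMFormCP n).pullback (𝓡 (2 * n)) Φ = -fubiniStudyMFormCP n := by
  have hn : ∀ u, ‖A u‖ = ‖u‖ :=
    norm_map_of_re_inner_map_eq A (fun a ↦ by rw [hA, Complex.conj_re])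
  have hA0 : ∀ u : 𝕎 n, u ≠ 0 → A u ≠ 0 := fun u hu h ↦
    hu (by rw [← norm_eq_zero, ← hn, h, norm_zero])
  funext p
  have hk : CoordNeZero (chartIndex p) p := coordNeZero_chartIndex p
  have hZ : homLift (chartIndex p) p ≠ 0 := homLift_ne_zero hk
  have hev : Φ =ᶠ[𝓝 p] (toCP ∘ (A ∘ homLift (chartIndex p))) := by
    filter_upwards [(isOpen_setOf_coordNeZero (chartIndex p)).mem_nhds hk] with q hq
    rw [Function.comp_apply, Function.comp_apply, ← hΦ _ (homLift_ne_zero hq), toCP_homLift hq]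
  have hG : MDifferentiableAt (𝓡 (2 * n)) 𝓘(ℝ, 𝕎 n) (A ∘ homLift (chartIndex p)) p :=
    A.hasMFDerivAt.mdifferentiableAt.comp p (mdifferentiableAt_homLift hk)
  have hF : MDifferentiableAt (𝓡 (2 * n)) (𝓡 (2 * n)) (toCP ∘ (A ∘ homLift (chartIndex p))) p :=
    (mdifferentiableAt_toCP (hA0 _ hZ)).comp p hG
  have hΦd : MDifferentiableAt (𝓡 (2 * n)) (𝓡 (2 * n)) Φ p := hF.congr_of_eventuallyEq hev
  rw [fubiniStudyMFormCP_pullback_congr_of_eventuallyEq hΦd hev,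
    fubiniStudyMFormCP_pullback_toCP_comp hG (hA0 _ hZ)]
  ext v
  rw [fubiniStudyMForm_pullback_apply, Function.comp_apply,
    mvfderiv_clm_comp_apply A (mdifferentiableAt_homLift hk),
    mvfderiv_clm_comp_apply A (mdifferentiableAt_homLift hk),
    fubiniStudyForm_of_inner_map_eq_conj A hA hZ, Pi.neg_apply,
    ContinuousAlternatingMap.neg_apply, fubiniStudyMFormCP_apply]

end ProjectiveSpace

end Literature.Geometry.Kaehler
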